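import Mathlib
import HarnessLib
import Summits.HubbardSuperconductivity.HubbardSuperconductivity.Theorems.KLProgrammeKLRegimeTwoPointAssemblyMatsubaraPartitionAllU
import Summits.HubbardSuperconductivity.HubbardSuperconductivity.Theorems.KLProgrammeKLRegimeVolumeLimitLastScaleCommonFrameDoor

/-!
# VL child `KLRegimeVolumeLimitV17F2` (stmt-HubbardSuperconductivity-20440), last scale: **THE UNIT PARTITION FUNCTIONS OF THE LAST-SCALE DOORS ARE
# FREE** — eventually in the Matsubara cutoff, for EVERY frame and EVERY coupling (Matsubara all-U bridge + last-scale frame exactness)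
# (cell gate-hubbard-kl, seat hubbard-kl-k3c4-p2 g9, technique «Matsubara all-U»)

Every last-scale door of 20440 (`…LastScaleDefectDoor`, `…ResummedDoor`, `…CommonFrameDoor`, `…CommonFrameDualDoor`) carries a hypothesis
`IsUnit Z^{n⋆}_{V,M}(K)` — the undressed one-shot partition function of a volume at the reading index `n⋆ = nScales β + 1` in some frame `K`.  It is FREE:
* at frame `0` and `Λ_{n⋆} < π/β` the one-shot covariance is the FULL free covariance (`hubbardCovAboveCT_eq_of_le`: temperature is the infrared cutoff) and
  `𝒩_0 = 0`, so `Z^{n⋆}_{L,M}(0) = ∫dμ_{C_M} e^{−V_M(U)}` (`effPartitionFn_lastScale_frame_zero_eq`);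
* t2's all-U Matsubara bridge [tree] `MatsubaraAllU.tendsto_effPartitionFn_hubbard_eq_partitionFn_div_allU` (`L ≥ 3`, `β > 0`, EVERY real `U`):
  `∫dμ_{C_M} e^{−V_M(U)} ⟶ e^{−βUL²/4}·Z_L(β;U,μ+U/2)/Z_L(β;0,μ) ≠ 0` (`Matrix.partitionFn_pos`), hence `Z^{n⋆}_{L,M}(0) ≠ 0` eventually in `M`
  (`effPartitionFn_hubbard_ne_zero_eventually`);
* unit-ness is frame-independent below temperature (`isUnit_effPartitionFn_frame_iff_lastScale`, this seat's `…TwoVolumeLastScaleFrameExact`):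
  **`isUnit_effPartitionFn_lastScale_eventually`** — `∃ M₀, ∀ M ≥ M₀, ∀ K, IsUnit Z^{n⋆}_{L,M}(K)`, ONE threshold for all frames.
Consequence (§2): the common-frame dual door with the unit AND the one-volume bound discharged —
**`framedNestedFlowTextV17F2_of_commonFrameDualRows`**: the registered stub text of `stub_vl_nestedFramed` from «per Matsubara integer ∃ L₀ δ→0 B: for
`L ≥ L₀`, `L″ = b·L`, eventually in `M`, ∃ pins: at every label of integer `n`, `2ε·(Ddef₊ + Dfar₊) ≤ δ L` (rows of `T_L(K_L) − 𝒩_{K_L}` vs `T_{L″}(K_L) − 𝒩_{K_L}`,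
BOTH at the coarse frame) and `2ε·Σ_y‖R_L(o_c;y)‖ ≤ B`» — nothing else; + `volumeLimitTextV17F2_of_commonFrameDualRows`.
Proofs only; no definitions; nothing asserts superconductivity.  References: BGM 2006 §2.4 (2.38); Bratteli–Robinson II §5.3.1 (Z > 0).
-/

noncomputable section

namespace Summit.HubbardSuperconductivity.HubbardSuperconductivity.Theorems.TwoVolumeDefect

set_option linter.dupNamespace false -- summit = problem name (single-conjunct summit), D-0017

open Finset Filter Topology Complex Literature.MathematicalPhysics.QuantumLattice Literature.Probability.LatticeModels GrassmannAlgebra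
open Summit.HubbardSuperconductivity.HubbardSuperconductivity.Theorems.KLRegimeSplit
open Summit.HubbardSuperconductivity.HubbardSuperconductivity.Theorems.KLProgrammeLegKernels
open Summit.HubbardSuperconductivity.HubbardSuperconductivity.Theorems.MatsubaraAllU

/-! ## §1 The last-scale partition functions are units, eventually in `M`, at every frame -/

section Units

variable {L : ℕ} [NeZero L] {β : ℝ} (hβ : 0 < β) (U μ : ℝ)
include hβ

/-- **At frame `0` the last-scale one-shot partition function is the plain Grassmann partition function** `∫dμ_{C_M} e^{−V_M(U)}`: temperature is the
infrared cutoff (`Λ_{n⋆} < π/β`) and `𝒩_0 = 0`. [cite: Salmhofer1999, §4.2.3] -/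
theorem effPartitionFn_lastScale_frame_zero_eq (M : ℕ) :
    effPartitionFn ℂ (normalCovariance L M (uvSymbolCT L M β μ 0 (klScale klE0 (nScales β + 1))))
        (hubbardInteraction L M β U + counterQuadratic L M β 0) =
      effPartitionFn ℂ (hubbardCovariance L M β μ 0) (hubbardInteraction L M β U) := by
  rw [← hubbardCovAboveCT_zero_seed_eq_normalCovariance_uvSymbolCT,
    hubbardCovAboveCT_eq_of_le L M hβ klScale_nScales_succ_pos (klScale_nScales_succ_lt hβ).le μ 0 0,
    hubbardCovarianceCT_zero_frame, counterQuadratic_zero, add_zero]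

open scoped ComplexOrder in
/-- **The plain Grassmann partition function is nonzero eventually in `M`** (`L ≥ 3`, EVERY `U`): its all-U Matsubara limit is
`e^{−βUL²/4}·Z_L(β;U,μ+U/2)/Z_L(β;0,μ)`, a quotient of positive traces. [cite: BenfattoGiulianiMastropietro2006, §2.1 (2.5)] -/
theorem effPartitionFn_hubbard_ne_zero_eventually (hL : 3 ≤ L) :
    ∀ᶠ M : ℕ in atTop, effPartitionFn ℂ (hubbardCovariance L M β μ 0) (hubbardInteraction L M β U) ≠ 0 := by
  have hlim := tendsto_effPartitionFn_hubbard_eq_partitionFn_div_allU hL hβ μ U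
  refine hlim.eventually_ne ?_
  have h1 : Matrix.partitionFn β (hubbardTorusWith 2 L 1 U (μ + U / 2)) ≠ 0 :=
    (Matrix.partitionFn_pos β (isHermitian_hamiltonianWith (fermionTorusGraph 2 L) 1 U (μ + U / 2))).ne'
  have h0 : Matrix.partitionFn β (hubbardTorusWith 2 L 1 0 μ) ≠ 0 :=
    (Matrix.partitionFn_pos β (isHermitian_hamiltonianWith (fermionTorusGraph 2 L) 1 0 μ)).ne'
  exact div_ne_zero (mul_ne_zero (by exact_mod_cast (Real.exp_pos _).ne') h1) h0

/-- **THE UNIT PARTITION FUNCTIONS OF THE LAST-SCALE DOORS ARE FREE**: for `L ≥ 3`, `β > 0`, every `U, μ` there is `M₀` such that for all `M ≥ M₀` and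
EVERY frame `K` the undressed one-shot partition function at the reading index `nScales β + 1` is a unit (frame `0` by the all-U bridge, every other frame by
`isUnit_effPartitionFn_frame_iff_lastScale`). [cite: BenfattoGiulianiMastropietro2006, §2.3 (2.24)] -/
theorem isUnit_effPartitionFn_lastScale_eventually (hL : 3 ≤ L) :
    ∃ M₀ : ℕ, ∀ (M : ℕ) [NeZero M], M₀ ≤ M → ∀ K : TrigPolyC4v,
      IsUnit (effPartitionFn ℂ (normalCovariance L M (uvSymbolCT L M β μ K (klScale klE0 (nScales β + 1))))
        (hubbardInteraction L M β U + counterQuadratic L M β K)) := by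
  obtain ⟨M₀, hM₀⟩ := eventually_atTop.1 (effPartitionFn_hubbard_ne_zero_eventually hβ U μ hL)
  refine ⟨M₀, fun M _ hM K => ?_⟩
  have h0 : IsUnit (effPartitionFn ℂ (normalCovariance L M (uvSymbolCT L M β μ 0 (klScale klE0 (nScales β + 1))))
      (hubbardInteraction L M β U + counterQuadratic L M β 0)) := by
    rw [effPartitionFn_lastScale_frame_zero_eq hβ U μ M]
    exact isUnit_iff_ne_zero.2 (hM₀ M hM)
  exact (isUnit_effPartitionFn_frame_iff_lastScale (L := L) (M := M) hβ U μ 0 K).2 h0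

end Units

end Summit.HubbardSuperconductivity.HubbardSuperconductivity.Theorems.TwoVolumeDefect

/-! ## §2 The common-frame dual door with the unit discharged -/

namespace Summit.HubbardSuperconductivity.HubbardSuperconductivity.Theorems.TwoPointAssembly

set_option linter.dupNamespace false -- summit = problem name (single-conjunct summit), D-0017

open Finset Filter Topology Complex Literature.MathematicalPhysics.QuantumLattice Literature.Probability.LatticeModels GrassmannAlgebra
open Summit.HubbardSuperconductivity.HubbardSuperconductivity.Theorems.KLRegimeSplit
open Summit.HubbardSuperconductivity.HubbardSuperconductivity.Theorems.KLProgrammeLegKernels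
open Summit.HubbardSuperconductivity.HubbardSuperconductivity.Theorems.TwoVolumeDefect

/-- **THE STUB TEXT OF «cauchy v8-F2» FROM DUAL-ROW DATA AT THE COMMON FRAME — NOTHING ELSE**: per Matsubara integer `∃ L₀ δ→0 B`, for `L ≥ L₀`, `L″ = b·L`,
eventually in `M`, pins `o_c, o_f` with, at every label of integer `n`, `2ε·(Ddef₊ + Dfar₊) ≤ δ L` for the rows of `T_L(K_L) − 𝒩_{K_L}` vs
`T_{L″}(K_L) − 𝒩_{K_L}` (BOTH at the coarse frame `K_L`) and `2ε·Σ_y‖R_L(o_c;y)‖ ≤ B`.  The unit partition function is supplied by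
`isUnit_effPartitionFn_lastScale_eventually` (at volume `L″ ≥ 3`), the frame passage by `…LastScaleFrameExact`, the frame values by the tower.
[cite: BenfattoGiulianiMastropietro2006, §2.4 (2.38)] -/
theorem framedNestedFlowTextV17F2_of_commonFrameDualRows
    (hD : ∀ (G : GeoConsts) (P : SplitConsts) (Q : EngConsts) (R : RenConsts), G.WF → P.WF → Q.WF → R.WF →
      ∃ c₅ : ℝ, 0 < c₅ ∧ ∀ c : ℝ, 0 < c → c ≤ c₅ → ∃ U₀ : ℝ, 0 < U₀ ∧
        ∀ μ ∈ klWindowC, ∀ U : ℝ, 0 < U → U ≤ U₀ → ∀ β : ℝ, klBetaMin ≤ β → β ≤ Real.exp (c / U ^ 2) →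
          ∀ K : TrigPolyC4v, klPredsV17F2.frameOK R U (nScales β) μ K →
            ∀ (Lstar : ℕ) (Mstar : ℕ → ℕ), TowerP klPredsV17F2 G P Q R β U μ K Lstar Mstar →
              ∀ n : ℤ, ∃ L₀ : ℕ, ∃ δ : ℕ → ℝ, ∃ B : ℝ, Tendsto δ atTop (𝓝 0) ∧
                ∀ (L : ℕ) [NeZero L], L₀ ≤ L → ∀ (L'' : ℕ) [NeZero L''] (b : ℕ), L'' = b * L → ∃ M₀ : ℕ, ∀ (M : ℕ) [NeZero M], M₀ ≤ M →
                  ∃ (oc : SpaceTimeIdx L M) (of : SpaceTimeIdx L'' M), ∀ ω : MatsubaraIdx M, matsubaraInt M ω = n →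
                    2 * imagTimeWeight β M *
                      ((∑ ybar : TorusSite 2 L,
                          ‖(∑ t₁ : ImagTimeIdx M,
                              sectorisedKernel L M β (trivialMultiplier L M)
                                  (klEffectiveAction L M β U μ (klFlowFrameU L M β U μ (nScales β + 1)) klE0 (nScales β + 1) -
                                    counterQuadratic L M β (klFlowFrameU L M β U μ (nScales β + 1))) 2
                                  (![((0, 0), 0), ((0, 0), 1)] : Fin 2 → SectorLeg 1) ![oc, (t₁, oc.2 + ybar)] *
                                Complex.exp (((matsubaraFreq β M ω * (imagTime β M oc.1 - imagTime β M t₁) : ℝ) : ℂ) * I)) -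
                            (∑ t₁ : ImagTimeIdx M,
                              sectorisedKernel L'' M β (trivialMultiplier L'' M)
                                  (klEffectiveAction L'' M β U μ (klFlowFrameU L M β U μ (nScales β + 1)) klE0 (nScales β + 1) -
                                    counterQuadratic L'' M β (klFlowFrameU L M β U μ (nScales β + 1))) 2
                                  (![((0, 0), 0), ((0, 0), 1)] : Fin 2 → SectorLeg 1) ![of, (t₁, of.2 + Torus.proj L'' (Torus.cRep ybar))] *
                                Complex.exp (((matsubaraFreq β M ω * (imagTime β M of.1 - imagTime β M t₁) : ℝ) : ℂ) * I))‖) +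
                        ∑ y ∈ univ.filter (fun y : TorusSite 2 L'' => Torus.proj L'' (Torus.cRep (fun i => (((y i).val : ℕ) : ZMod L))) ≠ y),
                          ‖∑ t₁ : ImagTimeIdx M,
                              sectorisedKernel L'' M β (trivialMultiplier L'' M)
                                  (klEffectiveAction L'' M β U μ (klFlowFrameU L M β U μ (nScales β + 1)) klE0 (nScales β + 1) -
                                    counterQuadratic L'' M β (klFlowFrameU L M β U μ (nScales β + 1))) 2
                                  (![((0, 0), 0), ((0, 0), 1)] : Fin 2 → SectorLeg 1) ![of, (t₁, of.2 + y)] *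
                                Complex.exp (((matsubaraFreq β M ω * (imagTime β M of.1 - imagTime β M t₁) : ℝ) : ℂ) * I)‖) ≤ δ L ∧
                    2 * imagTimeWeight β M * ∑ y : TorusSite 2 L,
                      ‖∑ t₁ : ImagTimeIdx M,
                          sectorisedKernel L M β (trivialMultiplier L M)
                              (klEffectiveAction L M β U μ (klFlowFrameU L M β U μ (nScales β + 1)) klE0 (nScales β + 1) -
                                counterQuadratic L M β (klFlowFrameU L M β U μ (nScales β + 1))) 2
                              (![((0, 0), 0), ((0, 0), 1)] : Fin 2 → SectorLeg 1) ![oc, (t₁, oc.2 + y)] *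
                            Complex.exp (((matsubaraFreq β M ω * (imagTime β M oc.1 - imagTime β M t₁) : ℝ) : ℂ) * I)‖ ≤ B) :
    ∀ (G : GeoConsts) (P : SplitConsts) (Q : EngConsts) (R : RenConsts), G.WF → P.WF → Q.WF → R.WF →
      ∃ c₅ : ℝ, 0 < c₅ ∧ ∀ c : ℝ, 0 < c → c ≤ c₅ → ∃ U₀ : ℝ, 0 < U₀ ∧
        ∀ μ ∈ klWindowC, ∀ U : ℝ, 0 < U → U ≤ U₀ → ∀ β : ℝ, klBetaMin ≤ β → β ≤ Real.exp (c / U ^ 2) →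
          ∀ K : TrigPolyC4v, klPredsV17F2.frameOK R U (nScales β) μ K →
            ∀ (Lstar : ℕ) (Mstar : ℕ → ℕ), TowerP klPredsV17F2 G P Q R β U μ K Lstar Mstar →
              ∀ n : ℤ, ∃ L₀ : ℕ, ∃ ρ : ℕ → ℝ, Tendsto ρ atTop (𝓝 0) ∧
                ∀ (L : ℕ) [NeZero L], L₀ ≤ L → ∀ (L'' : ℕ) [NeZero L''], L ∣ L'' → ∃ M₀ : ℕ, ∀ (M : ℕ) [NeZero M], M₀ ≤ M →
                  ∀ (ω : MatsubaraIdx M), matsubaraInt M ω = n → ∀ (k : TorusSite 2 L) (k'' : TorusSite 2 L''),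
                    latticeMomentum L'' k'' = latticeMomentum L k →
                      ‖klSelfEnergy L M β U μ (klFlowFrameU L M β U μ (nScales β + 1)) klE0 (nScales β + 1) (ω, k) 0 -
                          klSelfEnergy L'' M β U μ (klFlowFrameU L'' M β U μ (nScales β + 1)) klE0 (nScales β + 1) (ω, k'') 0‖ ≤ ρ L := by
  -- repackage `hD` as the hypothesis of `framedNestedFlowTextV17F2_of_commonFrameDualRowsText`: the unit is eventually free at the fine volume
  refine framedNestedFlowTextV17F2_of_commonFrameDualRowsText fun G P Q R hG hP hQ hR => ?_
  obtain ⟨c₅, hc₅, hc⟩ := hD G P Q R hG hP hQ hR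
  refine ⟨c₅, hc₅, fun c hc0 hcc => ?_⟩
  obtain ⟨U₀, hU₀, hU⟩ := hc c hc0 hcc
  refine ⟨U₀, hU₀, fun μ hμ U hU0 hUU β hβmin hβmax K hK Lstar Mstar hT n => ?_⟩
  have hβ : 0 < β := KLRegimeSplit.pos_of_klBetaMin_le hβmin
  obtain ⟨L₀, δ, B, hδ, hDn⟩ := hU μ hμ U hU0 hUU β hβmin hβmax K hK Lstar Mstar hT n
  refine ⟨max L₀ 3, δ, B, hδ, fun L _ hL L'' _ b hb => ?_⟩
  have hL₀ : L₀ ≤ L := (le_max_left _ _).trans hL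
  have hL3 : 3 ≤ L := (le_max_right _ _).trans hL
  have hL'' : 3 ≤ L'' := hL3.trans (Nat.le_of_dvd (Nat.pos_of_ne_zero (NeZero.ne L'')) ⟨b, by rw [hb, mul_comm]⟩)
  obtain ⟨M₀, hM₀⟩ := hDn L hL₀ L'' b hb
  obtain ⟨M₁, hM₁⟩ := isUnit_effPartitionFn_lastScale_eventually (L := L'') hβ U μ hL''
  refine ⟨max M₀ M₁, fun M _ hM => ?_⟩
  exact ⟨hM₁ M ((le_max_right _ _).trans hM) _, hM₀ M ((le_max_left _ _).trans hM)⟩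

/-- **The VL child text from dual-row data at the common frame** (∘ `volumeLimitTextV17F2_of_framedNestedFlowText`). [cite: BenfattoGiulianiMastropietro2006, §2.4 (2.38)] -/
theorem volumeLimitTextV17F2_of_commonFrameDualRows
    (hD : ∀ (G : GeoConsts) (P : SplitConsts) (Q : EngConsts) (R : RenConsts), G.WF → P.WF → Q.WF → R.WF →
      ∃ c₅ : ℝ, 0 < c₅ ∧ ∀ c : ℝ, 0 < c → c ≤ c₅ → ∃ U₀ : ℝ, 0 < U₀ ∧
        ∀ μ ∈ klWindowC, ∀ U : ℝ, 0 < U → U ≤ U₀ → ∀ β : ℝ, klBetaMin ≤ β → β ≤ Real.exp (c / U ^ 2) →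
          ∀ K : TrigPolyC4v, klPredsV17F2.frameOK R U (nScales β) μ K →
            ∀ (Lstar : ℕ) (Mstar : ℕ → ℕ), TowerP klPredsV17F2 G P Q R β U μ K Lstar Mstar →
              ∀ n : ℤ, ∃ L₀ : ℕ, ∃ δ : ℕ → ℝ, ∃ B : ℝ, Tendsto δ atTop (𝓝 0) ∧
                ∀ (L : ℕ) [NeZero L], L₀ ≤ L → ∀ (L'' : ℕ) [NeZero L''] (b : ℕ), L'' = b * L → ∃ M₀ : ℕ, ∀ (M : ℕ) [NeZero M], M₀ ≤ M →
                  ∃ (oc : SpaceTimeIdx L M) (of : SpaceTimeIdx L'' M), ∀ ω : MatsubaraIdx M, matsubaraInt M ω = n →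
                    2 * imagTimeWeight β M *
                      ((∑ ybar : TorusSite 2 L,
                          ‖(∑ t₁ : ImagTimeIdx M,
                              sectorisedKernel L M β (trivialMultiplier L M)
                                  (klEffectiveAction L M β U μ (klFlowFrameU L M β U μ (nScales β + 1)) klE0 (nScales β + 1) -
                                    counterQuadratic L M β (klFlowFrameU L M β U μ (nScales β + 1))) 2
                                  (![((0, 0), 0), ((0, 0), 1)] : Fin 2 → SectorLeg 1) ![oc, (t₁, oc.2 + ybar)] *
                                Complex.exp (((matsubaraFreq β M ω * (imagTime β M oc.1 - imagTime β M t₁) : ℝ) : ℂ) * I)) -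
                            (∑ t₁ : ImagTimeIdx M,
                              sectorisedKernel L'' M β (trivialMultiplier L'' M)
                                  (klEffectiveAction L'' M β U μ (klFlowFrameU L M β U μ (nScales β + 1)) klE0 (nScales β + 1) -
                                    counterQuadratic L'' M β (klFlowFrameU L M β U μ (nScales β + 1))) 2
                                  (![((0, 0), 0), ((0, 0), 1)] : Fin 2 → SectorLeg 1) ![of, (t₁, of.2 + Torus.proj L'' (Torus.cRep ybar))] *
                                Complex.exp (((matsubaraFreq β M ω * (imagTime β M of.1 - imagTime β M t₁) : ℝ) : ℂ) * I))‖) +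
                        ∑ y ∈ univ.filter (fun y : TorusSite 2 L'' => Torus.proj L'' (Torus.cRep (fun i => (((y i).val : ℕ) : ZMod L))) ≠ y),
                          ‖∑ t₁ : ImagTimeIdx M,
                              sectorisedKernel L'' M β (trivialMultiplier L'' M)
                                  (klEffectiveAction L'' M β U μ (klFlowFrameU L M β U μ (nScales β + 1)) klE0 (nScales β + 1) -
                                    counterQuadratic L'' M β (klFlowFrameU L M β U μ (nScales β + 1))) 2
                                  (![((0, 0), 0), ((0, 0), 1)] : Fin 2 → SectorLeg 1) ![of, (t₁, of.2 + y)] *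
                                Complex.exp (((matsubaraFreq β M ω * (imagTime β M of.1 - imagTime β M t₁) : ℝ) : ℂ) * I)‖) ≤ δ L ∧
                    2 * imagTimeWeight β M * ∑ y : TorusSite 2 L,
                      ‖∑ t₁ : ImagTimeIdx M,
                          sectorisedKernel L M β (trivialMultiplier L M)
                              (klEffectiveAction L M β U μ (klFlowFrameU L M β U μ (nScales β + 1)) klE0 (nScales β + 1) -
                                counterQuadratic L M β (klFlowFrameU L M β U μ (nScales β + 1))) 2
                              (![((0, 0), 0), ((0, 0), 1)] : Fin 2 → SectorLeg 1) ![oc, (t₁, oc.2 + y)] *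
                            Complex.exp (((matsubaraFreq β M ω * (imagTime β M oc.1 - imagTime β M t₁) : ℝ) : ℂ) * I)‖ ≤ B) :
    VolumeLimitP2 klPredsV17F2 FinalTwoLegVolLimitEx klWindowC :=
  volumeLimitTextV17F2_of_framedNestedFlowText (framedNestedFlowTextV17F2_of_commonFrameDualRows hD)

end Summit.HubbardSuperconductivity.HubbardSuperconductivity.Theorems.TwoPointAssembly

end
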